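import Mathlib
import Summits.NavierStokesRegularity.NavierStokesRegularity.Theorems.ThreadingFluxHorizonTowerProfileCurl
import HarnessLib

/-!
# Crux `PoloidalLiouville` (stmt-NavierStokesRegularity-1222, wall W1), crux idea «horizon-threading-tower» (ns-idea-15):
# RUNG R2 of the identification chain — the horizon profile in explicit `rpow` form and the Lamb vector `λ = U × Ω` in closed form

Support file (Theorems-side tooling, `--supports stmt-NavierStokesRegularity-1222 --as helper`; seat ns-wall-eng-7 g3, cell ns-wall-extremal).
Second rung of the STRUCTURED identification chain of the engine identity E-𝔏₂ (DATUM B-ht2, `pub/ns-wall-extremal/ARM-B/w7g3/L2-IDENTITY.md` §2).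
For `H` smooth, homogeneous of degree `l ≥ 1`, harmonic, and `x ≠ 0`:

* `HorizonTower.horizonProfile_eq_rpow` — `U_H(x) = (2(‖x‖²)^{(1−l)/2}) • ∇H(x) + (l(l−1)(‖x‖²)^{(1−l)/2−1} H(x)) • x`;
* `HorizonTower.cross_horizonProfile_curl` — with `κ = (l−1)(l+2)`, `T = (‖x‖²)^{−l}`, `V = (‖x‖²)^{−l−1}`:
  `U_H(x) × curl U_H(x) = (κ l(l+1) T H) • ∇H − (κ (2T‖∇H‖² + l²(l−1) V H²)) • x`
  (BAC–CAB with Euler `⟪∇H, x⟫ = lH`; coordinates).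

Pure vector calculus; information-grade for W1/W2; `PoloidalLiouville` (1222) / NS regularity OPEN and untouched. [folklore]
-/

-- the summit and its single problem share the name (D-0017 nested layout)
set_option linter.dupNamespace false

noncomputable section

open Set Function Filter Topology
open scoped Topology RealInnerProductSpace
open Literature.Analysis.FluidPDE
open Literature.Geometry.DiscreteGeometry (inner_fin3 norm_sq_fin3)

namespace Summit.NavierStokesRegularity.NavierStokesRegularity.Theorems.PoloidalLiouville.HorizonTower

open PoloidalField

section Lambda

variable {l : ℕ} {H : E3 → ℝ}

/-- The divergence of `∇φ`, `φ = ‖z‖^{1−l}H`, at a point off the origin, in closed form (harmonic `H`):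
`div ∇φ (y) = a(4l+4a+2)(‖y‖²)^{a−1} H(y)`, `a = (1−l)/2` (= `−(l−1)(l+2)(‖y‖²)^{−(l+1)/2} H(y)`). [folklore] -/
theorem divergence_gradient_potential (hl : 1 ≤ l) (hH : ContDiff ℝ (⊤ : ℕ∞) H)
    (hhom : ∀ (c : ℝ) (y : E3), H (c • y) = c ^ l * H y) (hharm : ∀ y, Laplacian.laplacian H y = 0) {y : E3} (hy : y ≠ 0) :
    VectorCalculus.divergence (gradient (fun z : E3 => ‖z‖ ^ ((1 : ℤ) - l) * H z)) y
      = (((1 : ℝ) - l) / 2 * (4 * l + 4 * (((1 : ℝ) - l) / 2) + 2)) * (H y * (‖y‖ ^ 2) ^ (((1 : ℝ) - l) / 2 - 1)) := by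
  have hopen' : ∀ᶠ z in 𝓝 y, z ≠ (0 : E3) := isOpen_compl_singleton.mem_nhds hy
  have hgrad : gradient (fun z : E3 => ‖z‖ ^ ((1 : ℤ) - l) * H z) =ᶠ[𝓝 y]
      gradient (fun z : E3 => H z * (‖z‖ ^ 2) ^ (((1 : ℝ) - l) / 2)) := by
    filter_upwards [hopen'] with z hz
    have hloc : (fun w : E3 => ‖w‖ ^ ((1 : ℤ) - l) * H w) =ᶠ[𝓝 z] fun w : E3 => H w * (‖w‖ ^ 2) ^ (((1 : ℝ) - l) / 2) := by
      filter_upwards [isOpen_compl_singleton.mem_nhds hz] with w hw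
      exact potential_eq_rpow hw
    unfold gradient
    rw [hloc.fderiv_eq]
  have h1 : VectorCalculus.divergence (gradient (fun z : E3 => ‖z‖ ^ ((1 : ℤ) - l) * H z)) y
      = VectorCalculus.divergence (gradient (fun z : E3 => H z * (‖z‖ ^ 2) ^ (((1 : ℝ) - l) / 2))) y := by
    simp only [VectorCalculus.divergence, hgrad.fderiv_eq]
  have _ := hl
  rw [h1, divergence_gradient_mul_rpow_normSq hy hH hhom hharm (((1 : ℝ) - l) / 2)]
  ring

/-- ★ **The horizon profile in explicit form** off the origin: `U_H(x) = (2(‖x‖²)^{(1−l)/2}) • ∇H(x) + (l(l−1)(‖x‖²)^{(1−l)/2−1} H(x)) • x`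
(`= 2r^{1−l}∇H + l(l−1)r^{−l−1}H x`). [folklore] -/
theorem horizonProfile_eq_rpow (hl : 1 ≤ l) (hH : ContDiff ℝ (⊤ : ℕ∞) H)
    (hhom : ∀ (c : ℝ) (y : E3), H (c • y) = c ^ l * H y) (hharm : ∀ y, Laplacian.laplacian H y = 0) {x : E3} (hx : x ≠ 0) :
    horizonProfile l H 0 x
      = (2 * (‖x‖ ^ 2) ^ (((1 : ℝ) - l) / 2)) • gradient H x
        + ((l : ℝ) * ((l : ℝ) - 1) * (‖x‖ ^ 2) ^ (((1 : ℝ) - l) / 2 - 1) * H x) • x := by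
  have hHd : DifferentiableAt ℝ H x := (hH.differentiable (by simp)).differentiableAt
  rw [horizonProfile_eq_normalForm hl hH hhom hx, divergence_gradient_potential hl hH hhom hharm hx]
  have hloc : (fun w : E3 => ‖w‖ ^ ((1 : ℤ) - l) * H w) =ᶠ[𝓝 x] fun w : E3 => H w * (‖w‖ ^ 2) ^ (((1 : ℝ) - l) / 2) := by
    filter_upwards [isOpen_compl_singleton.mem_nhds hx] with w hw
    exact potential_eq_rpow hw
  have hg : gradient (fun w : E3 => ‖w‖ ^ ((1 : ℤ) - l) * H w) x = gradient (fun w : E3 => H w * (‖w‖ ^ 2) ^ (((1 : ℝ) - l) / 2)) x := by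
    unfold gradient
    rw [hloc.fderiv_eq]
  rw [hg, gradient_mul_rpow_normSq hx hHd, smul_add, smul_smul, smul_smul, sub_eq_add_neg, ← neg_smul, add_assoc, ← add_smul]
  congr 1
  ring_nf

/-- ★ **R2: the Lamb vector of the horizon profile in closed form** off the origin (`κ = (l−1)(l+2)`):
`U_H × curl U_H = (κ l(l+1) (‖x‖²)^{−l} H) • ∇H − (κ (2(‖x‖²)^{−l} ‖∇H‖² + l²(l−1)(‖x‖²)^{−l−1} H²)) • x`. [folklore] -/
theorem cross_horizonProfile_curl (hl : 1 ≤ l) (hH : ContDiff ℝ (⊤ : ℕ∞) H)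
    (hhom : ∀ (c : ℝ) (y : E3), H (c • y) = c ^ l * H y) (hharm : ∀ y, Laplacian.laplacian H y = 0) {x : E3} (hx : x ≠ 0) :
    cross (horizonProfile l H 0 x) (curl (horizonProfile l H 0) x)
      = ((((l : ℝ) - 1) * ((l : ℝ) + 2)) * ((l : ℝ) * ((l : ℝ) + 1)) * (‖x‖ ^ 2) ^ (-(l : ℝ)) * H x) • gradient H x
        - ((((l : ℝ) - 1) * ((l : ℝ) + 2)) * (2 * (‖x‖ ^ 2) ^ (-(l : ℝ)) * ‖gradient H x‖ ^ 2
            + (l : ℝ) ^ 2 * ((l : ℝ) - 1) * (‖x‖ ^ 2) ^ (-(l : ℝ) - 1) * H x ^ 2)) • x := by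
  have hHd : DifferentiableAt ℝ H x := (hH.differentiable (by simp)).differentiableAt
  have hq : 0 < ‖x‖ ^ 2 := by positivity
  rw [horizonProfile_eq_rpow hl hH hhom hharm hx, curl_horizonProfile hl hH hhom hharm hx, norm_sq_fin3 (gradient H x)]
  -- Euler, the norm, and the power bookkeeping as scalar relations
  have hEu : gradient H x 0 * x 0 + gradient H x 1 * x 1 + gradient H x 2 * x 2 = (l : ℝ) * H x := by
    rw [← inner_fin3, inner_gradient_eq_fderiv, fderiv_apply_self_of_homogeneous_nat hHd hhom]
  have hNx : x 0 * x 0 + x 1 * x 1 + x 2 * x 2 = ‖x‖ ^ 2 := by rw [norm_sq_fin3]; ring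
  have r1 : (‖x‖ ^ 2) ^ (((1 : ℝ) - l) / 2) * (‖x‖ ^ 2) ^ (-((l : ℝ) + 1) / 2) = (‖x‖ ^ 2) ^ (-(l : ℝ)) := by
    rw [← Real.rpow_add hq]; congr 1; ring
  have r2 : (‖x‖ ^ 2) ^ (((1 : ℝ) - l) / 2 - 1) * (‖x‖ ^ 2) ^ (-((l : ℝ) + 1) / 2) = (‖x‖ ^ 2) ^ (-(l : ℝ) - 1) := by
    rw [← Real.rpow_add hq]; congr 1; ring
  have r3 : ‖x‖ ^ 2 * (‖x‖ ^ 2) ^ (-(l : ℝ) - 1) = (‖x‖ ^ 2) ^ (-(l : ℝ)) := by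
    conv_lhs => rw [show ‖x‖ ^ 2 * (‖x‖ ^ 2) ^ (-(l : ℝ) - 1) = (‖x‖ ^ 2) ^ (1 : ℝ) * (‖x‖ ^ 2) ^ (-(l : ℝ) - 1) by rw [Real.rpow_one]]
    rw [← Real.rpow_add hq]; congr 1; ring
  obtain ⟨c0, c1, c2⟩ := cross_fin3 (gradient H x) x
  obtain ⟨e0, e1, e2⟩ := cross_fin3
    ((2 * (‖x‖ ^ 2) ^ (((1 : ℝ) - l) / 2)) • gradient H x + ((l : ℝ) * ((l : ℝ) - 1) * (‖x‖ ^ 2) ^ (((1 : ℝ) - l) / 2 - 1) * H x) • x)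
    ((((l : ℝ) - 1) * ((l : ℝ) + 2) * (‖x‖ ^ 2) ^ (-((l : ℝ) + 1) / 2)) • cross (gradient H x) x)
  ext i
  fin_cases i
  · simp only [Fin.zero_eta, Fin.isValue, PiLp.sub_apply, PiLp.add_apply, PiLp.smul_apply, smul_eq_mul, e0, c1, c2]
    linear_combination (2 * gradient H x 0 * (‖x‖ ^ 2) ^ (((1 : ℝ) - l) / 2) * (‖x‖ ^ 2) ^ (-((l : ℝ) + 1) / 2) * (((l : ℝ) - 1) * ((l : ℝ) + 2))
          - x 0 * H x * (‖x‖ ^ 2) ^ (-((l : ℝ) + 1) / 2) * (‖x‖ ^ 2) ^ (((1 : ℝ) - l) / 2 - 1) * (((l : ℝ) - 1) * ((l : ℝ) + 2)) * (l : ℝ) ^ (2 : ℕ)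
          + x 0 * H x * (‖x‖ ^ 2) ^ (-((l : ℝ) + 1) / 2) * (‖x‖ ^ 2) ^ (((1 : ℝ) - l) / 2 - 1) * (((l : ℝ) - 1) * ((l : ℝ) + 2)) * (l : ℝ)) * hEu
      + (gradient H x 0 * H x * (‖x‖ ^ 2) ^ (-((l : ℝ) + 1) / 2) * (‖x‖ ^ 2) ^ (((1 : ℝ) - l) / 2 - 1) * (((l : ℝ) - 1) * ((l : ℝ) + 2)) * (l : ℝ) ^ (2 : ℕ)
          - gradient H x 0 * H x * (‖x‖ ^ 2) ^ (-((l : ℝ) + 1) / 2) * (‖x‖ ^ 2) ^ (((1 : ℝ) - l) / 2 - 1) * (((l : ℝ) - 1) * ((l : ℝ) + 2)) * (l : ℝ)) * hNx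
      + (-(2 * gradient H x 0 ^ (2 : ℕ) * x 0 * (((l : ℝ) - 1) * ((l : ℝ) + 2)))
          + 2 * gradient H x 0 * H x * (((l : ℝ) - 1) * ((l : ℝ) + 2)) * (l : ℝ)
          - 2 * gradient H x 1 ^ (2 : ℕ) * x 0 * (((l : ℝ) - 1) * ((l : ℝ) + 2))
          - 2 * gradient H x 2 ^ (2 : ℕ) * x 0 * (((l : ℝ) - 1) * ((l : ℝ) + 2))) * r1
      + (gradient H x 0 * H x * ‖x‖ ^ 2 * (((l : ℝ) - 1) * ((l : ℝ) + 2)) * (l : ℝ) ^ (2 : ℕ)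
          - gradient H x 0 * H x * ‖x‖ ^ 2 * (((l : ℝ) - 1) * ((l : ℝ) + 2)) * (l : ℝ)
          - x 0 * H x ^ (2 : ℕ) * (((l : ℝ) - 1) * ((l : ℝ) + 2)) * (l : ℝ) ^ (3 : ℕ)
          + x 0 * H x ^ (2 : ℕ) * (((l : ℝ) - 1) * ((l : ℝ) + 2)) * (l : ℝ) ^ (2 : ℕ)) * r2
      + (gradient H x 0 * H x * (((l : ℝ) - 1) * ((l : ℝ) + 2)) * (l : ℝ) ^ (2 : ℕ)
          - gradient H x 0 * H x * (((l : ℝ) - 1) * ((l : ℝ) + 2)) * (l : ℝ)) * r3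
  · simp only [Fin.mk_one, Fin.isValue, PiLp.sub_apply, PiLp.add_apply, PiLp.smul_apply, smul_eq_mul, e1, c0, c2]
    linear_combination (2 * gradient H x 1 * (‖x‖ ^ 2) ^ (((1 : ℝ) - l) / 2) * (‖x‖ ^ 2) ^ (-((l : ℝ) + 1) / 2) * (((l : ℝ) - 1) * ((l : ℝ) + 2))
          - x 1 * H x * (‖x‖ ^ 2) ^ (-((l : ℝ) + 1) / 2) * (‖x‖ ^ 2) ^ (((1 : ℝ) - l) / 2 - 1) * (((l : ℝ) - 1) * ((l : ℝ) + 2)) * (l : ℝ) ^ (2 : ℕ)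
          + x 1 * H x * (‖x‖ ^ 2) ^ (-((l : ℝ) + 1) / 2) * (‖x‖ ^ 2) ^ (((1 : ℝ) - l) / 2 - 1) * (((l : ℝ) - 1) * ((l : ℝ) + 2)) * (l : ℝ)) * hEu
      + (gradient H x 1 * H x * (‖x‖ ^ 2) ^ (-((l : ℝ) + 1) / 2) * (‖x‖ ^ 2) ^ (((1 : ℝ) - l) / 2 - 1) * (((l : ℝ) - 1) * ((l : ℝ) + 2)) * (l : ℝ) ^ (2 : ℕ)
          - gradient H x 1 * H x * (‖x‖ ^ 2) ^ (-((l : ℝ) + 1) / 2) * (‖x‖ ^ 2) ^ (((1 : ℝ) - l) / 2 - 1) * (((l : ℝ) - 1) * ((l : ℝ) + 2)) * (l : ℝ)) * hNx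
      + (-(2 * gradient H x 0 ^ (2 : ℕ) * x 1 * (((l : ℝ) - 1) * ((l : ℝ) + 2)))
          - 2 * gradient H x 1 ^ (2 : ℕ) * x 1 * (((l : ℝ) - 1) * ((l : ℝ) + 2))
          + 2 * gradient H x 1 * H x * (((l : ℝ) - 1) * ((l : ℝ) + 2)) * (l : ℝ)
          - 2 * gradient H x 2 ^ (2 : ℕ) * x 1 * (((l : ℝ) - 1) * ((l : ℝ) + 2))) * r1
      + (gradient H x 1 * H x * ‖x‖ ^ 2 * (((l : ℝ) - 1) * ((l : ℝ) + 2)) * (l : ℝ) ^ (2 : ℕ)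
          - gradient H x 1 * H x * ‖x‖ ^ 2 * (((l : ℝ) - 1) * ((l : ℝ) + 2)) * (l : ℝ)
          - x 1 * H x ^ (2 : ℕ) * (((l : ℝ) - 1) * ((l : ℝ) + 2)) * (l : ℝ) ^ (3 : ℕ)
          + x 1 * H x ^ (2 : ℕ) * (((l : ℝ) - 1) * ((l : ℝ) + 2)) * (l : ℝ) ^ (2 : ℕ)) * r2
      + (gradient H x 1 * H x * (((l : ℝ) - 1) * ((l : ℝ) + 2)) * (l : ℝ) ^ (2 : ℕ)
          - gradient H x 1 * H x * (((l : ℝ) - 1) * ((l : ℝ) + 2)) * (l : ℝ)) * r3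
  · simp only [Fin.reduceFinMk, Fin.isValue, PiLp.sub_apply, PiLp.add_apply, PiLp.smul_apply, smul_eq_mul, e2, c0, c1]
    linear_combination (2 * gradient H x 2 * (‖x‖ ^ 2) ^ (((1 : ℝ) - l) / 2) * (‖x‖ ^ 2) ^ (-((l : ℝ) + 1) / 2) * (((l : ℝ) - 1) * ((l : ℝ) + 2))
          - x 2 * H x * (‖x‖ ^ 2) ^ (-((l : ℝ) + 1) / 2) * (‖x‖ ^ 2) ^ (((1 : ℝ) - l) / 2 - 1) * (((l : ℝ) - 1) * ((l : ℝ) + 2)) * (l : ℝ) ^ (2 : ℕ)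
          + x 2 * H x * (‖x‖ ^ 2) ^ (-((l : ℝ) + 1) / 2) * (‖x‖ ^ 2) ^ (((1 : ℝ) - l) / 2 - 1) * (((l : ℝ) - 1) * ((l : ℝ) + 2)) * (l : ℝ)) * hEu
      + (gradient H x 2 * H x * (‖x‖ ^ 2) ^ (-((l : ℝ) + 1) / 2) * (‖x‖ ^ 2) ^ (((1 : ℝ) - l) / 2 - 1) * (((l : ℝ) - 1) * ((l : ℝ) + 2)) * (l : ℝ) ^ (2 : ℕ)
          - gradient H x 2 * H x * (‖x‖ ^ 2) ^ (-((l : ℝ) + 1) / 2) * (‖x‖ ^ 2) ^ (((1 : ℝ) - l) / 2 - 1) * (((l : ℝ) - 1) * ((l : ℝ) + 2)) * (l : ℝ)) * hNx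
      + (-(2 * gradient H x 0 ^ (2 : ℕ) * x 2 * (((l : ℝ) - 1) * ((l : ℝ) + 2)))
          - 2 * gradient H x 1 ^ (2 : ℕ) * x 2 * (((l : ℝ) - 1) * ((l : ℝ) + 2))
          - 2 * gradient H x 2 ^ (2 : ℕ) * x 2 * (((l : ℝ) - 1) * ((l : ℝ) + 2))
          + 2 * gradient H x 2 * H x * (((l : ℝ) - 1) * ((l : ℝ) + 2)) * (l : ℝ)) * r1
      + (gradient H x 2 * H x * ‖x‖ ^ 2 * (((l : ℝ) - 1) * ((l : ℝ) + 2)) * (l : ℝ) ^ (2 : ℕ)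
          - gradient H x 2 * H x * ‖x‖ ^ 2 * (((l : ℝ) - 1) * ((l : ℝ) + 2)) * (l : ℝ)
          - x 2 * H x ^ (2 : ℕ) * (((l : ℝ) - 1) * ((l : ℝ) + 2)) * (l : ℝ) ^ (3 : ℕ)
          + x 2 * H x ^ (2 : ℕ) * (((l : ℝ) - 1) * ((l : ℝ) + 2)) * (l : ℝ) ^ (2 : ℕ)) * r2
      + (gradient H x 2 * H x * (((l : ℝ) - 1) * ((l : ℝ) + 2)) * (l : ℝ) ^ (2 : ℕ)
          - gradient H x 2 * H x * (((l : ℝ) - 1) * ((l : ℝ) + 2)) * (l : ℝ)) * r3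

end Lambda

end Summit.NavierStokesRegularity.NavierStokesRegularity.Theorems.PoloidalLiouville.HorizonTower

end
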